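import Summits.ABC.ABC.Theses.DefiniteXi
import Summits.ABC.ABC.Theorems.DefiniteXiFreyModularity
import Summits.ABC.ABC.Theorems.DefiniteXiDefiniteRTControlPrimeSmulTransportDeg
import Summits.ABC.ABC.Theorems.DefiniteXiDefiniteRTControlPrimeValTransport
import Summits.ABC.ABC.Theorems.DefiniteXiDefiniteRTControlPrimeFreyScale
import Summits.ABC.ABC.Theorems.DefiniteXiDefiniteRTControlPrimeFreyLocal
import Literature.NumberTheory.Automorphic.ShimuraCurveRibetTakahashiComponentOrders
import Literature.NumberTheory.EllipticCurves.TakahashiDegreeFormulaCoprimeProofs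
import Literature.NumberTheory.EllipticCurves.PastenSpectralDegree
import Literature.NumberTheory.EllipticCurves.PastenHeightBounds
import Literature.NumberTheory.EllipticCurves.PastenHeightBoundsLemma68LocalProofs
import Literature.NumberTheory.EllipticCurves.PastenHeightBoundsLemma68Proofs
import Literature.NumberTheory.EllipticCurves.ModularCurveManinSemistableBridgeProofs
import Literature.NumberTheory.EllipticCurves.ModularDegreeMinimal
import Literature.NumberTheory.EllipticCurves.RationalIsogenyDegreesProofs
import HarnessLib

/-!
# stub-ideation k3 · gen 6 — helper signatures for `stub_pastenLemma68` (elab sanity only)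

Crux item stmt-ABC-11338 (`DefiniteXi.DefiniteRTControlPrime`); registered line `Lines/Sketch.lean`;
stub `stub_pastenLemma68 : PastenShimura2024_lemma_6_8`.  H1 is proved (10 lines, from the TREE theorem
`PastenShimura2024_lemma_6_8_isogeny_holds`); H2–H5 are signatures whose rc-0 proofs already sit in
`Cruxes/DefiniteRTControlPrime/StubIdeasK3G5PastenLemma68.lean` / `…K3G4…` (names given per item).
-/

noncomputable section

namespace Summit.ABC.ABC.Cruxes.DefiniteRTControlPrime.StubIdeas3G6

open Summit.ABC.ABC.Theses.DefiniteXi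
open Literature.NumberTheory.EllipticCurves Literature.NumberTheory.EllipticCurves.ModularForms
open Literature.NumberTheory.Automorphic
open WeierstrassCurve IsDedekindDomain

/-- **H1** (explicit-isogeny transport, `factorization` vocabulary, PROVED here from the tree theorem
`PastenShimura2024_lemma_6_8_isogeny_holds`): for an isogeny `α : A → B` over `ℚ` and a prime `p ∥ N_A`,
`c_p(B) ≤ deg α · c_p(A)` and `c_p(A) ≤ deg α · c_p(B)`. -/
theorem factorization_le_degree_mul_of_isogeny {A B : WeierstrassCurve ℚ} [A.IsElliptic]
    [B.IsElliptic] (α : Isogeny A B) (p : ℕ) (hp : p.Prime) (hpN : p ∣ A.conductorNorm ℤ)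
    (hp2 : ¬ p ^ 2 ∣ A.conductorNorm ℤ) :
    (B.minimalDiscriminantNorm ℤ).factorization p ≤
        α.degree * (A.minimalDiscriminantNorm ℤ).factorization p ∧
      (A.minimalDiscriminantNorm ℤ).factorization p ≤
        α.degree * (B.minimalDiscriminantNorm ℤ).factorization p := by
  obtain ⟨a, b, ha, hb, had, hbd, heq⟩ :=
    PastenShimura2024_lemma_6_8_isogeny_holds A B α p hp hpN hp2
  -- `heq : c_A * b = a * c_B`, `a b ∣ deg α`
  have hadle : a ≤ α.degree := Nat.le_of_dvd α.degree_pos had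
  have hbdle : b ≤ α.degree := Nat.le_of_dvd α.degree_pos hbd
  set cA := (A.minimalDiscriminantNorm ℤ).factorization p
  set cB := (B.minimalDiscriminantNorm ℤ).factorization p
  constructor
  · calc cB ≤ a * cB := Nat.le_mul_of_pos_left cB ha
      _ = cA * b := heq.symm
      _ ≤ cA * α.degree := Nat.mul_le_mul_left cA hbdle
      _ = α.degree * cA := mul_comm _ _
  · calc cA ≤ cA * b := Nat.le_mul_of_pos_right cA hb
      _ = a * cB := heq
      _ ≤ α.degree * cB := Nat.mul_le_mul_right cB hadle

/-- **H2** (`B`-parametric Lemma 6.8 from a class radius; `B = 163` + Mazur–Kenku radius = the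
verbatim stub, cf. tree `PastenShimura2024_lemma_6_8_of_mazurKenku'`; proof = that proof with `163 ↦ B`,
cyclicity not needed: `Isogeny.exists_isCyclic_degree_dvd`). -/
theorem lemma_6_8_le_of_classRadius (B : ℕ)
    (hR : ∀ (W W' : WeierstrassCurve ℚ) [W.IsElliptic] [W'.IsElliptic], W.IsIsogenous W' →
      ∃ φ : Isogeny W W', φ.degree ≤ B)
    (W W' : WeierstrassCurve ℚ) [W.IsElliptic] [W'.IsElliptic] (hiso : W.IsIsogenous W')
    (v : HeightOneSpectrum ℤ) (hv : W.HasMultiplicativeReductionAt v) :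
    ∃ m n : ℕ, 0 < m ∧ m ≤ B ∧ 0 < n ∧ n ≤ B ∧
      W.ordMinimalDiscriminant v * n = W'.ordMinimalDiscriminant v * m := by
  sorry

/-- **H3** (= K3G5 `exists_isogeny_degree_le_163`, rc 0 there): from a LATTICE-OPTIMAL datum `D₀`
(`Λ_{W₀} = c₀ Λ_f`) every isogenous globally-minimal `W'` is reached by an isogeny of degree `≤ 163`,
using only `PastenShimura2024_minimalDegree_le_163_mul`. -/
theorem exists_isogeny_degree_le_163_of_pasten163
    (h163 : PastenShimura2024_minimalDegree_le_163_mul)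
    {N : ℕ} [NeZero N] {W₀ W' : WeierstrassCurve ℚ} [W₀.IsElliptic] [W'.IsElliptic]
    [W'.IsGloballyMinimal] (D₀ : ModularParametrizationData W₀ N)
    (h₀ : ∀ z ∈ D₀.L.lattice, ∃ w ∈ periodLattice D₀.f, z = D₀.c * w)
    (hiso : W₀.IsIsogenous W') : ∃ ψ : Isogeny W₀ W', ψ.degree ≤ 163 := by
  sorry

/-- **H4** (= K3G5 `valTransportSq_of_pasten163_self`, rc 0 there): the DROP-IN replacement of the
registered skeleton's only use of `stub_pastenLemma68`
(`hval := stub_valTransport stub_pastenLemma68 …`), constant `163 ↦ 163 * 163`, hypotheses otherwise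
those already in scope at that line of `Lines/Sketch.lean`. -/
theorem valTransportSq_of_pasten163_self (h163 : PastenShimura2024_minimalDegree_le_163_mul)
    (a b : ℤ) (hab : IsCoprime a b) (h0 : a * b * (a + b) ≠ 0) {N : ℕ} [NeZero N]
    (D : ModularParametrizationData (freyCurve a b) N) (q : ℕ) (hq : q.Prime) (hq2 : q ≠ 2)
    (hqN : q ∣ (freyCurve a b).conductorNorm ℤ) (W' : WeierstrassCurve ℚ) [W'.IsElliptic]
    (hiso : (freyCurve a b).IsIsogenous W') :
    (W'.minimalDiscriminantNorm ℤ).factorization q ≤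
      163 * 163 * ((freyCurve a b).minimalDiscriminantNorm ℤ).factorization q := by
  sorry

/-- **H5** (= K3G4 `DefiniteRTControlPrime_of_two_facts`, rc 0 there, `C = 4·163³`): the crux from the
OTHER TWO registered stubs alone — the 2-stub closer a lead registers as `Lines/twofacts.lean`. -/
theorem DefiniteRTControlPrime_of_two_facts (hT : takahashi2001_thm_2_3_of_coprime)
    (h163 : PastenShimura2024_minimalDegree_le_163_mul) : DefiniteRTControlPrime := by
  sorry

/-- Assembly check: H5 is literally the crux from the two surviving stubs. -/
example (hT : takahashi2001_thm_2_3_of_coprime)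
    (h163 : PastenShimura2024_minimalDegree_le_163_mul) :
    Summit.ABC.ABC.Theses.DefiniteXi.DefiniteRTControlPrime :=
  DefiniteRTControlPrime_of_two_facts hT h163

/-- Assembly check for the verbatim stub: H2 at `B = 163` with the Mazur–Kenku radius in the
`∃ φ, φ.degree ≤ 163` form gives `PastenShimura2024_lemma_6_8` on the nose. -/
example (hR : ∀ (W W' : WeierstrassCurve ℚ) [W.IsElliptic] [W'.IsElliptic], W.IsIsogenous W' →
      ∃ φ : Isogeny W W', φ.degree ≤ 163) : PastenShimura2024_lemma_6_8 :=
  fun W W' _ _ hiso v hv => lemma_6_8_le_of_classRadius 163 hR W W' hiso v hv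

end Summit.ABC.ABC.Cruxes.DefiniteRTControlPrime.StubIdeas3G6
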